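import Literature.Probability.RandomPlanarGeometry.HexSAWBrickWallStripFugacityWidthOneContactBoundaryLimit
import HarnessLib

/-!
# The corners of the density triangle: costs of full adsorption, of the rung-free walks and of the zigzag

Child module of `…ContactBoundaryLimit` (the extended rate `J̄_{y,z}` on the CLOSED density triangle, positive off the typical pair, and the LDP
limit up to the boundary).  The three vertices and the adsorbed edge of the triangle are the EXTREME PHASES of the strip walk — all steps on
the bottom wall (`(½,0)`), on the top wall (`(0,½)`), rung-free with a prescribed sharing (`(a, ½−a)`), a rung at every third step (`(1/6,1/6)`).
* §1 ★★ the extended rate there in CLOSED FORM: `J̄(½,0) = log μ₁(y,z) − ½ log y`, `J̄(0,½) = log μ₁ − ½ log z`, on the whole adsorbed edge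
  `J̄(a,½−a) = log μ₁ − a log y − (½−a) log z` (AFFINE along the edge; constant when `y = z`), `J̄(1/6,1/6) = log μ₁ − (log y + log z)/6`;
* §2 ★★ all of them are POSITIVE (`rateExt_pos_of_ne`): `μ₁(y,z)² > y` (the tree's `max_lt_stripMuY₂_one_sq`, re-derived) and
  `μ₁(y,z)⁶ > yz`;
* §3 ★★★ **THE COST OF FULL ADSORPTION VANISHES AS `y → ∞`**: `0 < log μ₁(y,z) − ½ log y ≤ z/(2y(y−z))` for `y > z` — there is no adsorption
  transition at finite fugacity in width one, but the fully adsorbed phase becomes exponentially cheap like `z/(2y²)`.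

## Sources
JansevanRensburg2000 §3.3 and §5 (1st ed., OUP 2000: adsorbing walks, the ends of the density interval); DemboZeitouni2010 §2.2;
BeatonBousquetMelouDeGierDuminilCopinGuttmann2014 §3.2 Proposition 6 (arXiv v5 p. 10: the strip `S_1`).  Nothing quoted AS PRINTED.
-/

noncomputable section

open Filter Topology Finset Literature.Probability.LatticeModels Literature.Probability.Percolation SimpleGraph

namespace Literature.Probability.RandomPlanarGeometry.SAW.HexBW

open WidthOneYZ Real

variable {y z : ℝ}

/-! ## §1 The extended rate at the corners and on the adsorbed edge -/

/-- ★★ **The adsorbed edge**: for every `a`, `J̄_{y,z}(a, ½ − a) = log μ₁(y,z) − a log y − (½ − a) log z` (the extended entropy vanishes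
there): the rate is AFFINE along the edge of rung-free walks. [cite: JansevanRensburg2000, §3.3 (1st ed.; lane statement)] -/
theorem rateExt_adsorbedEdge (y z a : ℝ) :
    Real.log (stripMuY₂ 1 y z) - a * Real.log y - (1 / 2 - a) * Real.log z -
        (negMulLog (1 - 2 * a - 2 * (1 / 2 - a)) +
          (negMulLog (4 * a + 2 * (1 / 2 - a) - 1) + negMulLog (2 * a + 4 * (1 / 2 - a) - 1) - negMulLog (2 * a) -
            negMulLog (2 * (1 / 2 - a))) / 2) =
      Real.log (stripMuY₂ 1 y z) - a * Real.log y - (1 / 2 - a) * Real.log z := by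
  have e1 : (1 : ℝ) - 2 * a - 2 * (1 / 2 - a) = 0 := by ring
  have e2 : (4 : ℝ) * a + 2 * (1 / 2 - a) - 1 = 2 * a := by ring
  have e3 : (2 : ℝ) * a + 4 * (1 / 2 - a) - 1 = 2 * (1 / 2 - a) := by ring
  rw [e1, e2, e3, negMulLog_zero]; ring

/-- ★★ **The bottom vertex**: `J̄_{y,z}(½, 0) = log μ₁(y,z) − ½ log y` — the exponential cost of FULL ADSORPTION on the bottom wall.
[cite: JansevanRensburg2000, §3.3 (1st ed.; lane statement)] -/
theorem rateExt_vertex_half_zero (y z : ℝ) :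
    Real.log (stripMuY₂ 1 y z) - 1 / 2 * Real.log y - 0 * Real.log z -
        (negMulLog (1 - 2 * (1 / 2) - 2 * 0) +
          (negMulLog (4 * (1 / 2) + 2 * 0 - 1) + negMulLog (2 * (1 / 2) + 4 * 0 - 1) - negMulLog (2 * (1 / 2)) - negMulLog (2 * 0)) / 2) =
      Real.log (stripMuY₂ 1 y z) - Real.log y / 2 := by
  norm_num [negMulLog_zero, negMulLog_one]; ring

/-- ★★ **The top vertex**: `J̄_{y,z}(0, ½) = log μ₁(y,z) − ½ log z`. [cite: JansevanRensburg2000, §3.3 (1st ed.; lane statement)] -/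
theorem rateExt_vertex_zero_half (y z : ℝ) :
    Real.log (stripMuY₂ 1 y z) - 0 * Real.log y - 1 / 2 * Real.log z -
        (negMulLog (1 - 2 * 0 - 2 * (1 / 2)) +
          (negMulLog (4 * 0 + 2 * (1 / 2) - 1) + negMulLog (2 * 0 + 4 * (1 / 2) - 1) - negMulLog (2 * 0) - negMulLog (2 * (1 / 2))) / 2) =
      Real.log (stripMuY₂ 1 y z) - Real.log z / 2 := by
  norm_num [negMulLog_zero, negMulLog_one]; ring

/-- ★★ **The zigzag vertex**: `J̄_{y,z}(1/6, 1/6) = log μ₁(y,z) − (log y + log z)/6` — the cost of a rung at every third step.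
[cite: JansevanRensburg2000, §3.3 (1st ed.; lane statement)] -/
theorem rateExt_zigzag (y z : ℝ) :
    Real.log (stripMuY₂ 1 y z) - 1 / 6 * Real.log y - 1 / 6 * Real.log z -
        (negMulLog (1 - 2 * (1 / 6) - 2 * (1 / 6)) +
          (negMulLog (4 * (1 / 6) + 2 * (1 / 6) - 1) + negMulLog (2 * (1 / 6) + 4 * (1 / 6) - 1) - negMulLog (2 * (1 / 6)) -
            negMulLog (2 * (1 / 6))) / 2) =
      Real.log (stripMuY₂ 1 y z) - (Real.log y + Real.log z) / 6 := by
  have e1 : (1 : ℝ) - 2 * (1 / 6) - 2 * (1 / 6) = 1 / 3 := by norm_num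
  have e2 : (4 : ℝ) * (1 / 6) + 2 * (1 / 6) - 1 = 0 := by norm_num
  have e3 : (2 : ℝ) * (1 / 6) + 4 * (1 / 6) - 1 = 0 := by norm_num
  have e4 : (2 : ℝ) * (1 / 6) = 1 / 3 := by norm_num
  rw [e1, e2, e3, e4, negMulLog_zero]; ring

/-! ## §2 Positivity at the corners -/

/-- ★★ **`μ₁(y,z)² > y` via the boundary LDP** (the cost of full adsorption is positive: `(½,0)` is not the typical pair).  The inequality is
the tree's `max_lt_stripMuY₂_one_sq`; here it is the positivity of the extended rate at the bottom vertex.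
[cite: JansevanRensburg2000, §3.3 (1st ed.; lane statement); BeatonBousquetMelouDeGierDuminilCopinGuttmann2014, §3.2 Proposition 6 (arXiv v5 p. 10)] -/
theorem adsorptionCost_pos (hy : 0 < y) (hz : 0 < z) : 0 < Real.log (stripMuY₂ 1 y z) - Real.log y / 2 := by
  obtain ⟨t1, -, -⟩ := contactB_mem_triangle hy hz
  have hne : ((1 / 2 : ℝ), (0 : ℝ)) ≠ (contactB y z, contactB z y) := by
    intro h
    have e1 := (Prod.mk.inj h).1
    have e2 := (Prod.mk.inj h).2
    linarith
  have h := rateExt_pos_of_ne hy hz (x₁ := 1 / 2) (x₂ := 0) (by norm_num) (by norm_num) (by norm_num) hne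
  rw [rateExt_vertex_half_zero] at h
  exact h

/-- ★★ **`μ₁(y,z)⁶ > yz`**: the cost of the zigzag is positive (`(1/6,1/6)` is not the typical pair: `b + b' < ½` while the zigzag has
`1/6 + 1/6 = 1/3`… it is interior-adjacent but never typical since the typical rung density is `< 1/3`).
[cite: JansevanRensburg2000, §3.3 (1st ed.; lane statement)] -/
theorem zigzagCost_pos (hy : 0 < y) (hz : 0 < z) : 0 < Real.log (stripMuY₂ 1 y z) - (Real.log y + Real.log z) / 6 := by
  obtain ⟨-, t2, t3⟩ := contactB_mem_triangle hy hz
  have hne : ((1 / 6 : ℝ), (1 / 6 : ℝ)) ≠ (contactB y z, contactB z y) := by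
    intro h
    have e1 := (Prod.mk.inj h).1
    have e2 := (Prod.mk.inj h).2
    linarith
  have h := rateExt_pos_of_ne hy hz (x₁ := 1 / 6) (x₂ := 1 / 6) (by norm_num) (by norm_num) (by norm_num) hne
  rw [rateExt_zigzag] at h
  exact h

/-- The same as an algebraic inequality: `y·z < μ₁(y,z)⁶`. [cite: BeatonBousquetMelouDeGierDuminilCopinGuttmann2014, §3.2 Proposition 6 (arXiv v5 p. 10; lane statement)] -/
theorem mul_lt_stripMuY₂_one_pow_six (hy : 0 < y) (hz : 0 < z) : y * z < stripMuY₂ 1 y z ^ 6 := by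
  have h := zigzagCost_pos hy hz
  have hμ := stripMuY₂_pos 1 hy hz
  have h6 : Real.log (y * z) < Real.log (stripMuY₂ 1 y z ^ 6) := by
    rw [Real.log_mul hy.ne' hz.ne', Real.log_pow]; push_cast; linarith
  exact (Real.log_lt_log_iff (mul_pos hy hz) (pow_pos hμ 6)).1 h6

/-! ## §3 The cost of full adsorption vanishes as `y → ∞` -/

/-- ★★★ **NO ADSORPTION TRANSITION AT FINITE FUGACITY, QUANTIFIED**: for `y > z > 0`,
`0 < log μ₁(y,z) − ½ log y ≤ z/(2y(y − z))` — the exponential cost per step of the fully bottom-adsorbed phase is positive for every finite `y`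
but decays like `z/(2y²)` (the tree's `stripMuY₂_one_sq_sub_le`: `s − y ≤ z/(y−z)`, and `log(s/y) ≤ (s−y)/y`).
[cite: JansevanRensburg2000, §5 (1st ed.: adsorbing walks, the adsorbed phase; lane statement); BeatonBousquetMelouDeGierDuminilCopinGuttmann2014, §3.2 Proposition 6 (arXiv v5 p. 10)] -/
theorem adsorptionCost_le (hy : 0 < y) (hz : 0 < z) (hzy : z < y) :
    Real.log (stripMuY₂ 1 y z) - Real.log y / 2 ≤ z / (2 * y * (y - z)) := by
  have hμ := stripMuY₂_pos 1 hy hz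
  set s := stripMuY₂ 1 y z ^ 2 with hs
  have hsy : y < s := lt_of_le_of_lt (le_max_left _ _) (max_lt_stripMuY₂_one_sq hy hz)
  have hs0 : 0 < s := hy.trans hsy
  have hsub : s - y ≤ z / (y - z) := (stripMuY₂_one_sq_sub_le hy hz).1 hzy
  have hyz : 0 < y - z := by linarith
  -- `log μ₁ − ½ log y = ½ log(s/y) ≤ ½ (s/y − 1)`
  have e : Real.log (stripMuY₂ 1 y z) - Real.log y / 2 = Real.log (s / y) / 2 := by
    rw [Real.log_div hs0.ne' hy.ne', hs, Real.log_pow]; push_cast; ring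
  rw [e]
  have h1 : Real.log (s / y) ≤ s / y - 1 := Real.log_le_sub_one_of_pos (div_pos hs0 hy)
  have h2 : s / y - 1 = (s - y) / y := by field_simp
  have h3 : (s - y) / y ≤ (z / (y - z)) / y := div_le_div_of_nonneg_right hsub hy.le
  have h4 : (z / (y - z)) / y = z / (y * (y - z)) := by rw [div_div, mul_comm]
  have h5 : z / (2 * y * (y - z)) = (z / (y * (y - z))) / 2 := by field_simp
  rw [h5]
  linarith

/-- ★★★ **The cost of full adsorption tends to `0` as `y → ∞`** (at fixed `z > 0`). [cite: JansevanRensburg2000, §5 (1st ed.; lane statement)] -/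
theorem tendsto_adsorptionCost_atTop (hz : 0 < z) :
    Tendsto (fun y : ℝ => Real.log (stripMuY₂ 1 y z) - Real.log y / 2) atTop (𝓝 0) := by
  -- squeeze between `0` and `z/(2y(y−z)) → 0`
  have hup : Tendsto (fun y : ℝ => z / (2 * y * (y - z))) atTop (𝓝 0) := by
    have h1 : Tendsto (fun y : ℝ => 2 * y * (y - z)) atTop atTop := by
      have a : Tendsto (fun y : ℝ => y - z) atTop atTop := tendsto_atTop_add_const_right _ (-z) tendsto_id
      have b : Tendsto (fun y : ℝ => 2 * y) atTop atTop := tendsto_id.const_mul_atTop (by norm_num)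
      exact b.atTop_mul_atTop₀ a
    exact h1.const_div_atTop z |>.congr fun y => by ring_nf
  refine tendsto_of_tendsto_of_tendsto_of_le_of_le' tendsto_const_nhds hup ?_ ?_
  · filter_upwards [Filter.eventually_gt_atTop 0] with y hy
    exact (adsorptionCost_pos hy hz).le
  · filter_upwards [Filter.eventually_gt_atTop z] with y hy
    exact adsorptionCost_le (hz.trans hy) hz hy

end Literature.Probability.RandomPlanarGeometry.SAW.HexBW
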